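import Summits.KontsevichZagierPeriods.KontsevichZagierPeriods.Theses.SymplecticScissors
import Literature.NumberTheory.Transcendental.SemialgebraicMapsProofs

/-!
# `EqualJacobianTransport` (stmt-KontsevichZagierPeriods-9852, route SymplecticScissors): the engine

THE ENGINE of the route, typed in every dimension `n`: for `ℚ`-semialgebraic maps `Ψ₁, Ψ₂` which
are `C¹` and injective on an open `ℚ`-semialgebraic `U ⊆ ℝⁿ` with `det DΨ₁ ≠ 0` and
`|det DΨ₁| = |det DΨ₂|` on `U`, the integrand-`1` representations on `Ψ₁ '' U` and `Ψ₂ '' U`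
differ by ONE instance of KZ's change-of-variables move, the transition map
`Φ = Ψ₂ ∘ (Ψ₁|U)⁻¹` (`Function.invFunOn Ψ₁ U`):

* `Φ` is a `ℚ`-semialgebraic map on `Ψ₁ '' U`: the graph of `(Ψ₁|U)⁻¹` over `Ψ₁ '' U` is the
  block swap of the graph of `Ψ₁` over `U`, and semialgebraic maps compose (Tarski–Seidenberg,
  `IsSemialgebraicMapOn.comp_holds`);
* `Φ` is differentiable at every `q = Ψ₁ p`, `p ∈ U`, with derivative `DΨ₂(p) ∘ DΨ₁(p)⁻¹`: by the
  inverse function theorem (`HasStrictFDerivAt.to_local_left_inverse`) the left inverse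
  `(Ψ₁|U)⁻¹`, which inverts `Ψ₁` on the neighbourhood `U` of `p`, is strictly differentiable at
  `Ψ₁ p` with derivative `DΨ₁(p)⁻¹`; chain rule;
* `Φ` is injective on `Ψ₁ '' U` (`Ψ₂` is injective on `U`) and `Φ '' (Ψ₁ '' U) = Ψ₂ '' U`;
* `|det DΦ| = |det DΨ₂| / |det DΨ₁| = 1`, so `1 = 1 · |det DΦ|`.

This file proves the route support item verbatim (`equalJacobianTransport`); the planar Green
engine of the crux `PlanarCompiler` (stub `stub_shearedTransport`, `Ψ₁ = (a, A)`, `Ψ₂ = (b, B)`)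
is its specialisation.

References: the inverse function theorem (Mathlib,
`Mathlib/Analysis/Calculus/InverseFunctionTheorem/FDeriv.lean`); J. Bochnak, M. Coste, M.-F. Roy,
*Real Algebraic Geometry* (1998), Prop. 2.2.6–2.2.7 (semialgebraic maps); M. Kontsevich,
D. Zagier, *Periods* (2001), §1.2 rule (2). The bookkeeping is folklore; the semialgebraic
inverse is adapted from `Theorems/SymplecticScissorsPlanarSAZylevStubTeSymm.lean`.
The route decl `EqualJacobianTransport` was later dropped from the route file (lint autofix
2026-08-16T14:16:23Z, items-cap); it is re-created privately below, so the (append-only) statement of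
`equalJacobianTransport` is unchanged and nothing depends on the retired route name.
-/

noncomputable section

open MeasureTheory Set Filter Topology
open Literature.NumberTheory.Transcendental Literature.ModelTheory.ExponentialFields
open Summit.KontsevichZagierPeriods.KontsevichZagierPeriods.Theses.SymplecticScissors

/-- PRIVATE re-creation (route namespace stays free; a PROVED, now dropped route statement, NOT a
cited fact) of the route decl `…Theses.SymplecticScissors.EqualJacobianTransport`, item
stmt-KontsevichZagierPeriods-9852 (closed `proved` by `equalJacobianTransport` below @ p77208), which
the lint autofix of 2026-08-16T14:16:23Z DROPPED from `Theses/SymplecticScissors.lean` (items-cap,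
cone-unused support), so the name left the route file (full-build breakage, `Unknown identifier`):
the item's recorded signature verbatim, so that the append-only theorem keeps elaborating. -/
private def Summit.KontsevichZagierPeriods.KontsevichZagierPeriods.Theses.SymplecticScissors.EqualJacobianTransport :
    Prop :=
  ∀ (n : ℕ) (U : Set (Fin n → ℝ)) (Ψ₁ Ψ₂ : (Fin n → ℝ) → (Fin n → ℝ)), IsOpen U →
    Literature.ModelTheory.ExponentialFields.IsSemialgebraic ℚ U →
    Literature.NumberTheory.Transcendental.IsSemialgebraicMapOn ℚ U Ψ₁ →
    Literature.NumberTheory.Transcendental.IsSemialgebraicMapOn ℚ U Ψ₂ →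
    ContDiffOn ℝ 1 Ψ₁ U → ContDiffOn ℝ 1 Ψ₂ U → Set.InjOn Ψ₁ U → Set.InjOn Ψ₂ U →
    (∀ p ∈ U, (fderiv ℝ Ψ₁ p).det ≠ 0) →
    (∀ p ∈ U, |(fderiv ℝ Ψ₁ p).det| = |(fderiv ℝ Ψ₂ p).det|) →
    ∀ (r r' : Literature.NumberTheory.Transcendental.KZ.IntegralRep n),
      r.domain = Ψ₁ '' U → r'.domain = Ψ₂ '' U → (∀ q ∈ r.domain, r.integrand q = 1) →
      (∀ q ∈ r'.domain, r'.integrand q = 1) →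
      Literature.NumberTheory.Transcendental.KZ.of r - Literature.NumberTheory.Transcendental.KZ.of r' ∈
        Literature.NumberTheory.Transcendental.KZ.changeOfVariablesRel

namespace Summit.KontsevichZagierPeriods.SymplecticScissors.EqualJacobianTransport

variable {n : ℕ}

/-- On an open set `U`, a map which is `C¹` on `U` with `det (fderiv ℝ Ψ p) ≠ 0` has at every
`p ∈ U` a strict derivative which is a continuous linear equivalence (namely `fderiv ℝ Ψ p`).
[folklore] -/
theorem hasStrictFDerivAt_equiv {U : Set (Fin n → ℝ)} {Ψ : (Fin n → ℝ) → (Fin n → ℝ)}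
    (hUo : IsOpen U) (hΨ : ContDiffOn ℝ 1 Ψ U) {p : Fin n → ℝ} (hp : p ∈ U)
    (hdet : (fderiv ℝ Ψ p).det ≠ 0) :
    ∃ e : (Fin n → ℝ) ≃L[ℝ] (Fin n → ℝ), (e : (Fin n → ℝ) →L[ℝ] (Fin n → ℝ)) = fderiv ℝ Ψ p ∧
      HasStrictFDerivAt Ψ (e : (Fin n → ℝ) →L[ℝ] (Fin n → ℝ)) p := by
  -- adapted from `PlanarSAZylev.teSymm_hasStrictFDerivAt`
  refine ⟨(fderiv ℝ Ψ p).toContinuousLinearEquivOfDetNeZero hdet, by simp, ?_⟩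
  rw [ContinuousLinearMap.coe_toContinuousLinearEquivOfDetNeZero]
  exact (hΨ.contDiffAt (hUo.mem_nhds hp)).hasStrictFDerivAt one_ne_zero

/-- Near a point of the open set `U`, `Function.invFunOn Ψ U` is a left inverse of a map `Ψ`
injective on `U`. [folklore] -/
theorem eventually_left_inverse {U : Set (Fin n → ℝ)} {Ψ : (Fin n → ℝ) → (Fin n → ℝ)}
    (hUo : IsOpen U) (hinj : InjOn Ψ U) {p : Fin n → ℝ} (hp : p ∈ U) :
    ∀ᶠ x in 𝓝 p, Function.invFunOn Ψ U (Ψ x) = x :=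
  eventually_of_mem (hUo.mem_nhds hp) fun _ hx => hinj.leftInvOn_invFunOn hx

/-- **Derivative of the inverse** (inverse function theorem). If `Ψ` is `C¹` and injective on the
open set `U` and `e = fderiv ℝ Ψ p` is invertible at `p ∈ U`, then `Function.invFunOn Ψ U` has the
strict derivative `e⁻¹` at `Ψ p`. [folklore] -/
theorem hasStrictFDerivAt_invFunOn {U : Set (Fin n → ℝ)} {Ψ : (Fin n → ℝ) → (Fin n → ℝ)}
    (hUo : IsOpen U) (hinj : InjOn Ψ U) {p : Fin n → ℝ} (hp : p ∈ U)
    {e : (Fin n → ℝ) ≃L[ℝ] (Fin n → ℝ)}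
    (he : HasStrictFDerivAt Ψ (e : (Fin n → ℝ) →L[ℝ] (Fin n → ℝ)) p) :
    HasStrictFDerivAt (Function.invFunOn Ψ U)
      ((e.symm : (Fin n → ℝ) ≃L[ℝ] (Fin n → ℝ)) : (Fin n → ℝ) →L[ℝ] (Fin n → ℝ)) (Ψ p) :=
  he.to_local_left_inverse (eventually_left_inverse hUo hinj hp)

/-- **Graph of the inverse.** For `Ψ` injective on `U`, the graph of `Function.invFunOn Ψ U` over
`Ψ '' U` is the preimage of the graph of `Ψ` over `U` under the swap of the two coordinate blocks
of `Fin (n + n)`. [folklore] -/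
theorem graph_invFunOn {U : Set (Fin n → ℝ)} {Ψ : (Fin n → ℝ) → (Fin n → ℝ)} (hinj : InjOn Ψ U) :
    {z : Fin (n + n) → ℝ | ∃ y ∈ Ψ '' U, z = Fin.append y (Function.invFunOn Ψ U y)} =
      (fun z : Fin (n + n) → ℝ => z ∘ Fin.append (fun i : Fin n => (Fin.natAdd n i : Fin (n + n)))
          (fun j : Fin n => (Fin.castAdd n j : Fin (n + n)))) ⁻¹'
        {z : Fin (n + n) → ℝ | ∃ x ∈ U, z = Fin.append x (Ψ x)} := by
  -- adapted from `PlanarSAZylev.teSymm_graph_invFunOn` (there `n = 2`)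
  ext z
  simp only [mem_setOf_eq, mem_preimage]
  constructor
  · rintro ⟨_, ⟨x, hx, rfl⟩, rfl⟩
    refine ⟨x, hx, ?_⟩
    rw [hinj.leftInvOn_invFunOn hx]
    funext i
    induction i using Fin.addCases with
    | left i => simp only [Function.comp_apply, Fin.append_left, Fin.append_right]
    | right j => simp only [Function.comp_apply, Fin.append_right, Fin.append_left]
  · rintro ⟨x, hx, hz⟩
    refine ⟨Ψ x, ⟨x, hx, rfl⟩, ?_⟩
    rw [hinj.leftInvOn_invFunOn hx]
    funext i
    induction i using Fin.addCases with
    | left j =>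
      have h := congr_fun hz (Fin.natAdd n j)
      simp only [Function.comp_apply, Fin.append_right] at h
      simpa only [Fin.append_left] using h
    | right i =>
      have h := congr_fun hz (Fin.castAdd n i)
      simp only [Function.comp_apply, Fin.append_left] at h
      simpa only [Fin.append_right] using h

/-- **Semialgebraicity of the inverse.** If `Ψ` is a `ℚ`-semialgebraic map on `U`, injective on
`U`, then `Function.invFunOn Ψ U` is a `ℚ`-semialgebraic map on `Ψ '' U` (its graph is a
coordinate permutation of the graph of `Ψ`; Bochnak–Coste–Roy 1998, §2.2). [folklore] -/
theorem isSemialgebraicMapOn_invFunOn {U : Set (Fin n → ℝ)} {Ψ : (Fin n → ℝ) → (Fin n → ℝ)}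
    (hΨ : IsSemialgebraicMapOn ℚ U Ψ) (hinj : InjOn Ψ U) :
    IsSemialgebraicMapOn ℚ (Ψ '' U) (Function.invFunOn Ψ U) := by
  unfold IsSemialgebraicMapOn at hΨ ⊢
  rw [graph_invFunOn hinj]
  exact hΨ.preimage_comp _

/-- **The transition map is semialgebraic.** For `ℚ`-semialgebraic maps `Ψ₁, Ψ₂` on `U` with `Ψ₁`
injective on `U`, the transition map `Ψ₂ ∘ (Ψ₁|U)⁻¹` is a `ℚ`-semialgebraic map on `Ψ₁ '' U`
(composition of semialgebraic maps, Tarski–Seidenberg). [folklore] -/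
theorem isSemialgebraicMapOn_transition {U : Set (Fin n → ℝ)}
    {Ψ₁ Ψ₂ : (Fin n → ℝ) → (Fin n → ℝ)} (hΨ₁ : IsSemialgebraicMapOn ℚ U Ψ₁)
    (hΨ₂ : IsSemialgebraicMapOn ℚ U Ψ₂) (hinj : InjOn Ψ₁ U) :
    IsSemialgebraicMapOn ℚ (Ψ₁ '' U) (Ψ₂ ∘ Function.invFunOn Ψ₁ U) :=
  IsSemialgebraicMapOn.comp_holds hΨ₂ (isSemialgebraicMapOn_invFunOn hΨ₁ hinj)
    (surjOn_image Ψ₁ U).mapsTo_invFunOn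

/-- Determinant of a composite of continuous linear endomorphisms. [folklore] -/
theorem det_comp {E : Type*} [NormedAddCommGroup E] [NormedSpace ℝ E] (f g : E →L[ℝ] E) :
    (f.comp g).det = f.det * g.det := by
  show LinearMap.det ((f.comp g : E →L[ℝ] E) : E →ₗ[ℝ] E) = _
  rw [ContinuousLinearMap.toLinearMap_comp, LinearMap.det_comp]

/-- **THE ENGINE** (route support item `EqualJacobianTransport`, stmt-KontsevichZagierPeriods-9852):
for `ℚ`-semialgebraic `C¹` maps `Ψ₁, Ψ₂` injective on an open `ℚ`-semialgebraic `U` with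
`det DΨ₁ ≠ 0` and `|det DΨ₁| = |det DΨ₂|` on `U`, the integrand-`1` representations on `Ψ₁ '' U`
and `Ψ₂ '' U` differ by ONE change-of-variables instance, `Φ = Ψ₂ ∘ (Ψ₁|U)⁻¹` (inverse function
theorem, Tarski–Seidenberg, `|det DΦ| = 1`). [folklore] -/
theorem equalJacobianTransport : EqualJacobianTransport := by
  intro n U Ψ₁ Ψ₂ hUo _hUsa hΨ₁sa hΨ₂sa hΨ₁C1 hΨ₂C1 hinj₁ hinj₂ hdet hdeteq r r' hr hr' hri hri'
  -- the transition map and its derivative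
  set g : (Fin n → ℝ) → (Fin n → ℝ) := Function.invFunOn Ψ₁ U
  have hgΨ : ∀ p ∈ U, g (Ψ₁ p) = p := fun p hp => hinj₁.leftInvOn_invFunOn hp
  refine ⟨n, r, r', Ψ₂ ∘ g,
    fun q => (fderiv ℝ Ψ₂ (g q)).comp (fderiv ℝ Ψ₁ (g q)).inverse, ?_, ?_, ?_, ?_, ?_, rfl⟩
  · -- semialgebraic
    rw [hr]
    exact isSemialgebraicMapOn_transition hΨ₁sa hΨ₂sa hinj₁
  · -- derivative within the (open) domain
    rw [hr]
    rintro _ ⟨p, hp, rfl⟩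
    obtain ⟨e, hefd, he⟩ := hasStrictFDerivAt_equiv hUo hΨ₁C1 hp (hdet p hp)
    have hginv : HasStrictFDerivAt g
        ((e.symm : (Fin n → ℝ) ≃L[ℝ] (Fin n → ℝ)) : (Fin n → ℝ) →L[ℝ] (Fin n → ℝ)) (Ψ₁ p) :=
      hasStrictFDerivAt_invFunOn hUo hinj₁ hp he
    have hΨ₂ : HasFDerivAt Ψ₂ (fderiv ℝ Ψ₂ p) (g (Ψ₁ p)) := by
      rw [hgΨ p hp]
      exact ((hΨ₂C1.contDiffAt (hUo.mem_nhds hp)).differentiableAt one_ne_zero).hasFDerivAt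
    have hcomp := hΨ₂.comp (Ψ₁ p) hginv.hasFDerivAt
    have hinv : (fderiv ℝ Ψ₁ p).inverse =
        ((e.symm : (Fin n → ℝ) ≃L[ℝ] (Fin n → ℝ)) : (Fin n → ℝ) →L[ℝ] (Fin n → ℝ)) := by
      rw [← hefd, ContinuousLinearMap.inverse_equiv]
    refine HasFDerivAt.hasFDerivWithinAt ?_
    simpa only [hgΨ p hp, hinv] using hcomp
  · -- injective
    rw [hr]
    rintro _ ⟨p, hp, rfl⟩ _ ⟨q, hq, rfl⟩ h
    simp only [Function.comp_apply, hgΨ p hp, hgΨ q hq] at h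
    rw [hinj₂ hp hq h]
  · -- image
    rw [hr, hr', image_image]
    exact image_congr fun p hp => by simp only [Function.comp_apply, hgΨ p hp]
  · -- Jacobian factor
    rw [hr]
    rintro _ ⟨p, hp, rfl⟩
    have hmem : (Ψ₂ ∘ g) (Ψ₁ p) ∈ r'.domain := by
      rw [hr']
      exact ⟨p, hp, by simp only [Function.comp_apply, hgΨ p hp]⟩
    rw [hri _ (hr ▸ mem_image_of_mem Ψ₁ hp), hri' _ hmem]
    obtain ⟨e, hefd, -⟩ := hasStrictFDerivAt_equiv hUo hΨ₁C1 hp (hdet p hp)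
    have hinv : (fderiv ℝ Ψ₁ p).inverse =
        ((e.symm : (Fin n → ℝ) ≃L[ℝ] (Fin n → ℝ)) : (Fin n → ℝ) →L[ℝ] (Fin n → ℝ)) := by
      rw [← hefd, ContinuousLinearMap.inverse_equiv]
    have hd1 : (fderiv ℝ Ψ₁ p).det ≠ 0 := hdet p hp
    beta_reduce
    rw [hgΨ p hp, hinv, det_comp, ContinuousLinearEquiv.det_coe_symm, hefd, abs_mul, abs_inv,
      ← hdeteq p hp, mul_inv_cancel₀ (abs_ne_zero.mpr hd1), mul_one]

end Summit.KontsevichZagierPeriods.SymplecticScissors.EqualJacobianTransport
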